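import Summits.ABC.IUTFork.Cor312PinnedIdentified
import Summits.ABC.IUTFork.DAGC312g
import Summits.ABC.IUTFork.ForkThm110
import HarnessLib

/-!
# Branch C certificate — NON-VACUITY of the per-curve hypothesis group of `abc_of_S` (companion of `Conditional/AbcOfS.lean`)

PROOF-ONLY record file of the abc-iut cell, branch C «CONDITIONAL VERIFICATION abc ⇐ S» (rung LADDER-ABC:A2.C; writer
abc-iut-C-cert-1; cell rule «vacuity-audit every fork-level hypothesis with a non-vacuity witness»). TAKES NO SIDE on [IUTchIII]
Cor. 3.12; asserts nothing about any elliptic curve.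

`Conditional/AbcOfS.lean` (p427180) proves `abc_of_S`: the summit statement `ABC` from, PER CURVE `P` of the family, the hypothesis
group [S] `Cor312Vol.PilotKummerIndRelated` · [PIN] `Cor312Vol.PinnedRegions3`, `Cor312Vol.BridgeHyps` · [CONE] node
`DAG.N_IUTchIII_Thm3_11_ii` · [READ] `hΘ` (the setting's `−|log(Θ)|`, when finite, is the Thm-1.10 number), `hq` (`−|log(q)| = −|log(q)|` of
the Thm-1.10 data), plus the family-level inputs `V T A hInd`. An implication whose per-curve hypotheses were JOINTLY UNSATISFIABLE at
every datum would certify nothing. THIS FILE shows they are jointly satisfiable — at an INTERFACE-LEVEL, CONTENTFUL typed-Thm-3.11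
instance of record: abc-iut-w5-d247's LINK-IDENTIFIED pinned setting P♭ (`Cor312Vol.NaiveWitness.linkIdSetting 2` over `naiveFull 2`,
operator `ballOfMonoid`, q-datum `Ψ = {(±q^{j²})_j}`; `Cor312PinnedIdentified.lean` p420441), paired with Thm-1.10 numbers `X` MATCHING its
two volumes (`l = 7`, `log(q) = 35·log 2` so that `|log(q)| = (1/2l)·log(q) = (5/2)·log 2 = −(P♭'s −|log(q)|)`, `−|log(Θ)| = −(5/2)·log 2`):
there every per-curve binder of `abc_of_S` holds, the typed Corollary 3.12 holds (attained as an equality, Team R's identified-copies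
reading) and the skeleton's per-curve `Thm110Data.Cor312` holds — `abc_of_S_perCurve_hypotheses_satisfiable`.

WHAT THIS DOES NOT SAY (honest scope). (1) Interface/toy level: one place, `l⋇ = 2`, formal ball volumes (`Cor312PinnedIdentified`
§HONEST SCOPE). (2) The witness is the IDENTIFIED-COPIES / link-identified reading (ADJUDICATION-SPEC (G-PINNED-4) (d) clause (1):
the residual S «HOLDS under the identified-copies reading (G4, `Cor312Proof.pilotKummerIndRelated_of_identified` p419954; non-vacuous as
P♭ p419474)»); at HONESTLY `j²`-SCALED pin-respecting settings with `|log(q)| > 0` the tree REFUTES S (abc-iut-w4-d103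
`PinnedHonest.not_gapA''_of_scaled_of_absLogQPos` p418630 with `reading3_iff_pilotKummerIndRelated`; abc-iut-w5-d155 p419757; the honest-q
twin P♯ `honestQ_not_pilotKummerIndRelated`). Whether any reading SUPPLIES S at the genuine data is branch B's census and the
adjudication's question, not C's: C certifies «abc ⇐ S + named hypotheses» and, here, that the per-curve antecedent is consistent.
(3) Family-level joint satisfiability of ALL binders of `abc_of_S` (incl. `V T A hInd`, or in the campaign-S form F-1336 + (P7) + the
Thm-1.10 proof data for EVERY admissible λ) is not witnessed — by `abc_of_S` itself such a witness would prove `ABC`.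
[claim: Mochizuki2012, status: disputed] [cite: ScholzeStix2018, §2.2 pp. 9–10] Standard axioms; typed ≠ proved; instantiated ≠ endorsed.
-/

noncomputable section

namespace Summit.ABC.IUTFork.Conditional

open Thm311 Cor312Vol Cor312Vol.NaiveWitness Cor312Vol.GluedMonoids.Naive

/-- **The per-curve hypothesis group of `abc_of_S` is jointly satisfiable** (interface level): at P♭ = `linkIdSetting 2` over the
contentful typed-Thm-3.11 instance `naiveFull 2` (operator `ballOfMonoid`, q-datum `Ψ`), with the Thm-1.10 numbers
`l = 7`, `log(q) = 35·log 2`, `−|log(Θ)| = −(5/2)·log 2`: [S] `PilotKummerIndRelated` ∧ [PIN] `PinnedRegions3` ∧ `BridgeHyps` ∧ [CONE]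
`DAG.N_IUTchIII_Thm3_11_ii` ∧ [READ] `hΘ` ∧ `hq` all hold, and so do the typed Corollary 3.12 for P♭ and the skeleton's `Thm110Data.Cor312`
for these numbers. Witness of record: abc-iut-w5-d247 (`linkId_pilotKummerIndRelated`, `linkId_pinnedRegions3`, `linkId_bridgeHyps`,
`naiveFull_statement`, `linkId_statement_attained`, `linkId_negLogQ`). The antecedent of `abc_of_S` is therefore not contradictory per
curve; at honestly `j²`-scaled pinned settings S fails (p418630/p419757) — see the module docstring. [claim: Mochizuki2012, status: disputed] -/
theorem abc_of_S_perCurve_hypotheses_satisfiable :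
    ∃ (T : ThetaIndex) (F : LatticeSituation T) (P312 : Cor312.Setting F.toSituation)
      (ρ : (∀ v : T.V, v ∈ T.Vbad → Set (F.L.StarPacket v)) → ∀ (j : T.Label) (vQ : T.VQ), Set (F.L.Packet j vQ))
      (qK : ∀ v : T.V, v ∈ T.Vbad → Set (F.L.StarPacket v)) (X : Thm110Data),
      Cor312Vol.PilotKummerIndRelated F P312 ρ qK ∧ Cor312Vol.PinnedRegions3 F P312 ρ qK ∧ Cor312Vol.BridgeHyps P312 ∧
        DAG.N_IUTchIII_Thm3_11_ii F ∧
        (∀ x : ℝ, P312.negLogTheta = (x : WithTop ℝ) → X.negLogTheta = x) ∧ P312.negLogQ = -X.absLogq ∧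
        P312.Statement ∧ X.Cor312 := by
  haveI : Fact (Nat.Prime 2) := ⟨Nat.prime_two⟩
  have hlog : 0 < Real.log 2 := Real.log_pos one_lt_two
  refine ⟨_, (naiveFull 2).toLatticeSituation, linkIdSetting 2, ballOfMonoid 2, fun v _ => Psi 2 v,
    { l := 7, seven_le_l := le_rfl, dmod := 1, one_le_dmod := le_rfl, estar := 0, estar_nonneg := le_rfl,
      eta := 0, eta_nonneg := le_rfl, logdf := 0, logdf_nonneg := le_rfl,
      logq := 35 * Real.log 2, logq_pos := by positivity, negLogTheta := -(5 / 2) * Real.log 2 },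
    linkId_pilotKummerIndRelated 2, linkId_pinnedRegions3 2, linkId_bridgeHyps 2, (naiveFull_statement 2).2.1,
    fun x hx => ?_, ?_, (linkId_statement_attained 2).1, ?_⟩
  · -- hΘ: P♭'s −|log(Θ)| is attained at −|log(q)| = −(5/2)·log 2
    have h := (linkId_statement_attained 2).2
    rw [hx, linkId_negLogQ] at h
    exact (WithTop.coe_inj.mp h).symm ▸ rfl
  · -- hq: −(5/2)·log 2 = −(35·log 2)/(2·7)
    rw [linkId_negLogQ]
    show -(5 / 2) * Real.log 2 = -(35 * Real.log 2 / (2 * ((7 : ℕ) : ℝ)))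
    push_cast
    ring
  · -- the skeleton's Cor312 for these numbers: −|log(q)| ≤ −|log(Θ)| (here an equality)
    show -(35 * Real.log 2 / (2 * ((7 : ℕ) : ℝ))) ≤ -(5 / 2) * Real.log 2
    push_cast
    linarith

end Summit.ABC.IUTFork.Conditional

end
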